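import Mathlib.AlgebraicGeometry.Morphisms.FlatDescent
import Mathlib.AlgebraicGeometry.Morphisms.Flat
import Mathlib.AlgebraicGeometry.Morphisms.ClosedImmersion
import Mathlib.AlgebraicGeometry.Morphisms.AffineAnd
import Mathlib.RingTheory.Flat.FaithfullyFlat.Descent
import Literature.AlgebraicGeometry.Morphisms.FlatFpqcDescent
import HarnessLib

/-!
# Affine morphisms and closed immersions descend along fpqc covers

The Stacks Project, Tags 02L5, 02L6 and 02KU (Descent, Lemmas 35.23.18, 35.23.19 and 35.23.6):
the properties "affine", "closed immersion" and "separated" of a morphism of schemes `g : Y → Z`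
are local on the base for the fpqc topology — if the base change of `g` along a surjective, flat,
quasi-compact `f : X → Z` has the property, then so does `g`. Mathlib (`Morphisms/FlatDescent`)
descends "universally closed / open / injective", "isomorphism", "open immersion", "flat",
"surjective" (and the tree adds "finite étale" modulo separatedness, `Morphisms/FiniteEtaleFpqcDescent`,
whose docstring records that Mathlib has no descent of closed immersions); this file adds the two missing
elementary ones (separatedness, Stacks 02KU, is ★ `LaurentSchroer2023.isSeparated_of_isPullback`).

Road (Stacks 02L5, first reducing to an affine base `Z = Spec R` and an affine cover `X = Spec S`
by Mathlib's `IsZariskiLocalAtTarget.descendsAlong_inf_quasiCompact`): if `Y ×_R S` is affine then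
`Y` is quasi-compact and quasi-separated (private `compactSpace_of_surjective`,
`quasiSeparatedSpace_of_isAffineHom_of_surjective`), so by FLAT BASE CHANGE OF `H⁰` (Mathlib
`isIso_pushoutSection_of_isQuasiSeparated_of_flat_right`) the square of rings
`R → Γ(Y)`, `S → Γ(Y ×_R S)` is a pushout, i.e. `Spec Γ(Y ×_R S) = Spec Γ(Y) ×_{Spec R} Spec S`;
with the naturality of `toSpecΓ` this makes
`(Y ×_R S → Y, toSpecΓ, toSpecΓ, Spec Γ(Y ×_R S) → Spec Γ(Y))` a pull-back square whose left leg is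
an isomorphism (`Y ×_R S` is affine) and whose bottom is an fpqc cover, so `Y → Spec Γ(Y)` is an
isomorphism by Mathlib's descent of isomorphisms: `Y` is affine (`isAffine_of_isPullback_Spec`).
Closed immersions = affine + surjective on rings, and surjectivity of a ring map descends along a
faithfully flat extension (Mathlib `RingHom.FaithfullyFlat.codescendsAlong_surjective`).

* `isAffineHom_descendsAlong` — **Stacks 02L5**:
  `IsAffineHom.DescendsAlong (@Surjective ⊓ @Flat ⊓ @QuasiCompact)`; readings
  `isAffineHom_of_isPullback_fpqc`, `isAffine_of_isPullback_fpqc`;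
* `isClosedImmersion_descendsAlong` — **Stacks 02L6**; reading `isClosedImmersion_of_isPullback_fpqc`;
* (Stacks 02KU, separatedness, is already ★ `LaurentSchroer2023.isSeparated_of_isPullback`);
* field extensions (`Spec K → Spec κ` is an fpqc cover, ★ `surjective_and_flat_SpecMap_of_field`):
  `isAffine_of_isAffine_pullback_SpecMap_of_field`, `isAffineOpen_of_isAffineOpen_preimage_of_field`
  — a `κ`-scheme (resp. an open of it) is affine as soon as it is so after an extension of the base
  field (consumer: descent of ampleness along field extensions).

Everything is proved; theorems only (no definitions, instances, facts, notation).

## References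

* The Stacks Project, Tags 02L5, 02L6, 02KU (Descent, § 35.23), 02KH (flat base change).
  [StacksProject]
* U. Görtz, T. Wedhorn, *Algebraic Geometry I*, 2nd ed. (2020), Prop. 14.53 (4) and (6) (faithfully
  flat descent of "closed immersion" and "affine"; read via the held copy). [GortzWedhorn2020]
-/

noncomputable section

-- Mathlib's `pushoutSection` API is stated across semireducible wrappers (as in Mathlib's own file).
set_option backward.isDefEq.respectTransparency false

universe u

open CategoryTheory CategoryTheory.Limits AlgebraicGeometry TopologicalSpace

namespace Literature.AlgebraicGeometry.Morphisms

/-! ## §1 Quasi-compactness and quasi-separatedness descend -/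

/-- The image of a quasi-compact scheme under a surjective morphism is quasi-compact. [folklore] -/
private theorem compactSpace_of_surjective {X Y : Scheme.{u}} (p : X ⟶ Y) [Surjective p] [CompactSpace X] :
    CompactSpace Y := by
  constructor
  rw [← Set.image_univ_of_surjective p.surjective]
  exact isCompact_univ.image p.continuous

/-- A scheme receiving a surjective AFFINE morphism from a quasi-separated scheme is
quasi-separated (the intersection of two affine opens is the image of the intersection of their
affine preimages). [cite: StacksProject, Tag 02L5] -/
theorem quasiSeparatedSpace_of_isAffineHom_of_surjective {X Y : Scheme.{u}} (p : X ⟶ Y)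
    [Surjective p] [IsAffineHom p] [QuasiSeparatedSpace X] : QuasiSeparatedSpace Y := by
  rw [quasiSeparatedSpace_iff_forall_affineOpens]
  intro U V
  have hU : IsAffineOpen (p ⁻¹ᵁ U.1) := U.2.preimage p
  have hV : IsAffineOpen (p ⁻¹ᵁ V.1) := V.2.preimage p
  have h : IsCompact ((p ⁻¹ᵁ U.1 : Set X) ∩ (p ⁻¹ᵁ V.1 : Set X)) :=
    QuasiSeparatedSpace.inter_isCompact _ _ (p ⁻¹ᵁ U.1).2 hU.isCompact (p ⁻¹ᵁ V.1).2 hV.isCompact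
  have hUV : (U ∩ V : Set Y) = p '' ((p ⁻¹ᵁ U.1 : Set X) ∩ (p ⁻¹ᵁ V.1 : Set X)) := by
    change (U ∩ V : Set Y) = p '' (p ⁻¹' (U : Set Y) ∩ p ⁻¹' (V : Set Y))
    rw [← Set.preimage_inter, Set.image_preimage_eq _ p.surjective]
  rw [hUV]
  exact h.image p.continuous

/-! ## §2 The core: `Y ×_R S` affine, `R → S` faithfully flat ⇒ `Y` affine -/

section Core

variable {R S : CommRingCat.{u}} (φ : R ⟶ S) {Y Y' : Scheme.{u}} {g : Y ⟶ Spec R}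
  {g' : Y' ⟶ Y} {iY : Y' ⟶ Spec S}

/-- `Spec` of the map on global sections of `Spec S → Spec R` is again surjective, flat (and
quasi-compact) when `Spec S → Spec R` is surjective and flat (it is conjugate to it by the
isomorphisms `toSpecΓ`). [folklore] -/
private theorem surjective_flat_SpecMap_appTop [Surjective (Spec.map φ)] [Flat (Spec.map φ)] :
    Surjective (Spec.map (Spec.map φ).appTop) ∧ Flat (Spec.map (Spec.map φ).appTop) := by
  have e : Spec.map (Spec.map φ).appTop = inv (Spec S).toSpecΓ ≫ Spec.map φ ≫ (Spec R).toSpecΓ := by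
    rw [IsIso.eq_inv_comp, Scheme.toSpecΓ_naturality]
  rw [e]
  exact ⟨inferInstance, inferInstance⟩

/-- **The core of Stacks 02L5.** For a cartesian square `Y' = Y ×_{Spec R} Spec S` with
`Spec S → Spec R` surjective and flat: if `Y'` is affine then `Y` is affine. Flat base change of
`H⁰` makes `Spec Γ(Y') = Spec Γ(Y) ×_{Spec R} Spec S`, so `Y' → Y` over `toSpecΓ`'s is a pull-back
square with an isomorphism on the left and an fpqc cover at the bottom; isomorphisms descend.
[cite: StacksProject, Tag 02L5] -/
theorem isAffine_of_isPullback_Spec [Surjective (Spec.map φ)] [Flat (Spec.map φ)]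
    (H : IsPullback g' iY g (Spec.map φ)) [IsAffine Y'] : IsAffine Y := by
  -- `g'` is affine and surjective (a base change of `Spec S → Spec R`), so `Y` is qcqs
  haveI : IsAffineHom g' := MorphismProperty.of_isPullback (P := @IsAffineHom) H.flip inferInstance
  haveI : Surjective g' := MorphismProperty.of_isPullback (P := @Surjective) H.flip inferInstance
  haveI : CompactSpace Y := compactSpace_of_surjective g'
  haveI : QuasiSeparatedSpace Y := quasiSeparatedSpace_of_isAffineHom_of_surjective g'
  -- flat base change of `H⁰`: the square of global sections is a pushout
  have hUST : (⊤ : (Spec S).Opens) ≤ Spec.map φ ⁻¹ᵁ ⊤ := le_top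
  have hUSX : (⊤ : Y.Opens) ≤ g ⁻¹ᵁ ⊤ := le_top
  have hUY : (⊤ : Y'.Opens) = g' ⁻¹ᵁ ⊤ ⊓ iY ⁻¹ᵁ ⊤ := by simp
  have hiso := isIso_pushoutSection_of_isQuasiSeparated_of_flat_right H hUST hUSX hUY
    (isAffineOpen_top _) (isAffineOpen_top _) isCompact_univ isQuasiSeparated_univ
  have hpo := (isIso_pushoutSection_iff H hUST hUSX hUY).mp hiso
  -- read the `appLE ⊤ ⊤`'s as `appTop`'s
  have e₁ : g.appLE ⊤ ⊤ hUSX = g.appTop := (Scheme.Hom.app_eq_appLE g).symm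
  have e₂ : (Spec.map φ).appLE ⊤ ⊤ hUST = (Spec.map φ).appTop :=
    (Scheme.Hom.app_eq_appLE (Spec.map φ)).symm
  have e₃ : g'.appLE ⊤ ⊤ (by simp) = g'.appTop := (Scheme.Hom.app_eq_appLE g').symm
  have e₄ : iY.appLE ⊤ ⊤ (by simp) = iY.appTop := (Scheme.Hom.app_eq_appLE iY).symm
  rw [e₁, e₂, e₃, e₄] at hpo
  -- `Spec` of the pushout: the bottom pull-back square
  have t : IsPullback (Spec.map g'.appTop) (Spec.map iY.appTop) (Spec.map g.appTop)
      (Spec.map (Spec.map φ).appTop) :=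
    isPullback_SpecMap_of_isPushout _ _ _ _ hpo
  -- the big rectangle: `H` on top of the (iso) naturality square of `Spec S → Spec R`
  have sq : IsPullback (Spec.map φ) (Spec S).toSpecΓ (Spec R).toSpecΓ
      (Spec.map (Spec.map φ).appTop) :=
    IsPullback.of_vert_isIso ⟨Scheme.toSpecΓ_naturality (Spec.map φ)⟩
  have s : IsPullback g' (Y'.toSpecΓ ≫ Spec.map iY.appTop) (Y.toSpecΓ ≫ Spec.map g.appTop)
      (Spec.map (Spec.map φ).appTop) := by
    rw [← Scheme.toSpecΓ_naturality iY, ← Scheme.toSpecΓ_naturality g]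
    exact H.paste_vert sq
  -- hence the top square is a pull-back
  have top : IsPullback g' Y'.toSpecΓ Y.toSpecΓ (Spec.map g'.appTop) :=
    IsPullback.of_bot s (Scheme.toSpecΓ_naturality g') t
  -- its bottom is an fpqc cover (a base change of `Spec S → Spec R`), its left leg an isomorphism
  obtain ⟨hs, hfl⟩ := surjective_flat_SpecMap_appTop φ
  haveI : Surjective (Spec.map g'.appTop) :=
    MorphismProperty.of_isPullback (P := @Surjective) t.flip hs
  haveI : Flat (Spec.map g'.appTop) := MorphismProperty.of_isPullback (P := @Flat) t.flip hfl
  have hY : IsIso Y.toSpecΓ :=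
    MorphismProperty.of_isPullback_of_descendsAlong (P := MorphismProperty.isomorphisms Scheme.{u})
      (Q := @Surjective ⊓ @Flat ⊓ @QuasiCompact) top.flip ⟨⟨‹_›, ‹_›⟩, inferInstance⟩
      (IsAffine.affine (X := Y'))
  exact ⟨hY⟩

/-- Stacks 02L5 over an affine base in `pullback` form: `Y ×_{Spec R} Spec S` affine
(`Spec S → Spec R` surjective and flat) ⇒ `Y` affine. [cite: StacksProject, Tag 02L5] -/
theorem isAffine_of_isAffine_pullback_Spec (g : Y ⟶ Spec R) [Surjective (Spec.map φ)]
    [Flat (Spec.map φ)] [IsAffine (pullback (Spec.map φ) g)] : IsAffine Y :=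
  isAffine_of_isPullback_Spec φ (IsPullback.of_hasPullback (Spec.map φ) g).flip

end Core

/-! ## §3 Stacks 02L5: affine morphisms descend along fpqc covers -/

/-- **Stacks 02L5: the property "affine" of morphisms of schemes descends along surjective, flat,
quasi-compact morphisms (fpqc covers).** [cite: StacksProject, Tag 02L5]
[cite: GortzWedhorn2020, Prop. 14.53 (6)] -/
theorem isAffineHom_descendsAlong :
    MorphismProperty.DescendsAlong @IsAffineHom (@Surjective ⊓ @Flat ⊓ @QuasiCompact) := by
  apply IsZariskiLocalAtTarget.descendsAlong_inf_quasiCompact (P := @IsAffineHom)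
    (P' := @Surjective ⊓ @Flat)
  · rw [inf_comm]
    exact inf_le_inf le_rfl (IsLocalIso.le_of_isZariskiLocalAtSource _)
  · intro R S Y φ g hφ h
    haveI : Surjective (Spec.map φ) := hφ.1
    haveI : Flat (Spec.map φ) := hφ.2
    haveI : IsAffineHom (pullback.fst (Spec.map φ) g) := h
    haveI : IsAffine (pullback (Spec.map φ) g) := isAffine_of_isAffineHom (pullback.fst (Spec.map φ) g)
    haveI : IsAffine Y := isAffine_of_isAffine_pullback_Spec φ g
    infer_instance

/-- Stacks 02L5, square form: for a cartesian square `P = X ×_Z Y` with `X → Z` surjective, flat and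
quasi-compact, if `P → X` is affine then `Y → Z` is affine. [cite: StacksProject, Tag 02L5] -/
theorem isAffineHom_of_isPullback_fpqc {P X Y Z : Scheme.{u}} {fst : P ⟶ X} {snd : P ⟶ Y} {f : X ⟶ Z}
    {g : Y ⟶ Z} (h : IsPullback fst snd f g) [Surjective f] [Flat f] [QuasiCompact f]
    [IsAffineHom fst] : IsAffineHom g :=
  haveI := isAffineHom_descendsAlong.{u}
  MorphismProperty.of_isPullback_of_descendsAlong (P := @IsAffineHom)
    (Q := @Surjective ⊓ @Flat ⊓ @QuasiCompact) h ⟨⟨‹_›, ‹_›⟩, ‹_›⟩ ‹_›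

/-- Stacks 02L5 for `pullback.snd`: if the base change `X ×_Z Y → Y` of `f : X → Z` along an fpqc
cover `Y → Z` is affine, then `f` is affine. [cite: StacksProject, Tag 02L5] -/
theorem isAffineHom_of_isAffineHom_pullback_snd {X Y Z : Scheme.{u}} (f : X ⟶ Z) (g : Y ⟶ Z)
    [Surjective g] [Flat g] [QuasiCompact g] [IsAffineHom (pullback.snd f g)] : IsAffineHom f :=
  isAffineHom_of_isPullback_fpqc (IsPullback.of_hasPullback f g).flip

/-- Stacks 02L5 for schemes over an affine base: `Y ×_Z X` affine for an fpqc cover `X → Z` with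
`X` and `Z` affine ⇒ `Y` affine. [cite: StacksProject, Tag 02L5] -/
theorem isAffine_of_isPullback_fpqc {P X Y Z : Scheme.{u}} {fst : P ⟶ X} {snd : P ⟶ Y} {f : X ⟶ Z}
    {g : Y ⟶ Z} (h : IsPullback fst snd f g) [Surjective f] [Flat f] [QuasiCompact f]
    [IsAffine P] [IsAffine X] [IsAffine Z] : IsAffine Y :=
  haveI : IsAffineHom fst := inferInstance
  haveI : IsAffineHom g := isAffineHom_of_isPullback_fpqc h
  isAffine_of_isAffineHom g

/-! ## §4 Stacks 02L6 and 02KU: closed immersions and separatedness descend -/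

/-- **Stacks 02L6: closed immersions descend along fpqc covers.** A closed immersion into an affine
scheme is an affine source plus a surjection on global sections; the source is affine by 02L5, and
surjectivity of `R → Γ(Y)` descends along the faithfully flat `R → S`.
[cite: StacksProject, Tag 02L6] [cite: GortzWedhorn2020, Prop. 14.53 (4)] -/
theorem isClosedImmersion_descendsAlong :
    MorphismProperty.DescendsAlong @IsClosedImmersion (@Surjective ⊓ @Flat ⊓ @QuasiCompact) := by
  apply IsZariskiLocalAtTarget.descendsAlong_inf_quasiCompact (P := @IsClosedImmersion)
    (P' := @Surjective ⊓ @Flat)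
  · rw [inf_comm]
    exact inf_le_inf le_rfl (IsLocalIso.le_of_isZariskiLocalAtSource _)
  · intro R S Y φ g hφ h
    haveI : Surjective (Spec.map φ) := hφ.1
    haveI : Flat (Spec.map φ) := hφ.2
    -- the source is affine: Stacks 02L5
    haveI : IsAffine Y := by
      haveI : IsClosedImmersion (pullback.fst (Spec.map φ) g) := h
      haveI : IsAffine (pullback (Spec.map φ) g) :=
        isAffine_of_isAffineHom (pullback.fst (Spec.map φ) g)
      exact isAffine_of_isAffine_pullback_Spec φ g
    -- `Y = Spec T`; surjectivity of `R → T` descends from `S → S ⊗_R T`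
    wlog hY : ∃ T, Y = Spec T generalizing Y
    · rw [← MorphismProperty.cancel_left_of_respectsIso @IsClosedImmersion Y.isoSpec.inv]
      have heq : pullback.fst (Spec.map φ) (Y.isoSpec.inv ≫ g) =
          pullback.map _ _ _ _ (𝟙 _) Y.isoSpec.inv (𝟙 _) (by simp) (by simp) ≫
            pullback.fst (Spec.map φ) g := (pullback.lift_fst _ _ _).symm
      refine this (Y := Spec Γ(Y, ⊤)) (Y.isoSpec.inv ≫ g) ?_ inferInstance ⟨_, rfl⟩
      rw [heq, MorphismProperty.cancel_left_of_respectsIso @IsClosedImmersion]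
      exact h
    obtain ⟨T, rfl⟩ := hY
    have hP : HasAffineProperty @IsClosedImmersion
        (affineAnd fun f => Function.Surjective f) := IsClosedImmersion.hasAffineProperty
    refine of_pullback_fst_Spec_of_codescendsAlong (P := @IsClosedImmersion)
      (P' := @Surjective ⊓ @Flat) (Q := fun f => Function.Surjective f)
      (Q' := fun f => f.FaithfullyFlat) RingHom.FaithfullyFlat.codescendsAlong_surjective ?_ ?_ hφ h
    · intro R S f hf
      rwa [← flat_and_surjective_SpecMap_iff, and_comm]
    · intro R S f
      exact HasAffineProperty.SpecMap_iff_of_affineAnd hP RingHom.surjective_respectsIso f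

/-- Stacks 02L6, square form. [cite: StacksProject, Tag 02L6] -/
theorem isClosedImmersion_of_isPullback_fpqc {P X Y Z : Scheme.{u}} {fst : P ⟶ X} {snd : P ⟶ Y}
    {f : X ⟶ Z} {g : Y ⟶ Z} (h : IsPullback fst snd f g) [Surjective f] [Flat f] [QuasiCompact f]
    [IsClosedImmersion fst] : IsClosedImmersion g :=
  haveI := isClosedImmersion_descendsAlong.{u}
  MorphismProperty.of_isPullback_of_descendsAlong (P := @IsClosedImmersion)
    (Q := @Surjective ⊓ @Flat ⊓ @QuasiCompact) h ⟨⟨‹_›, ‹_›⟩, ‹_›⟩ ‹_›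

-- Stacks 02KU (separatedness descends) is ★ `Literature.AlgebraicGeometry.LaurentSchroer2023.isSeparated_of_isPullback`
-- (via Mathlib's "proper monomorphism = closed immersion"); not restated here.

/-! ## §5 Extensions of the base field -/

/-- **Affineness descends along extensions of the base field**: for a `κ`-scheme `X` (`κ` a field)
and a ring map `κ → K` into a nonzero ring, if `X ×_κ K` is affine then `X` is affine.
[cite: StacksProject, Tag 02L5] -/
theorem isAffine_of_isAffine_pullback_SpecMap_of_field {κ : Type u} [Field κ] {K : CommRingCat.{u}}
    [Nontrivial K] (φ : CommRingCat.of κ ⟶ K) {X : Scheme.{u}} (f : X ⟶ Spec (.of κ))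
    [IsAffine (pullback (Spec.map φ) f)] : IsAffine X := by
  obtain ⟨h₁, h₂⟩ := surjective_and_flat_SpecMap_of_field φ
  haveI := h₁
  haveI := h₂
  exact isAffine_of_isAffine_pullback_Spec φ f

/-- Cartesian-square form of `isAffine_of_isAffine_pullback_SpecMap_of_field`: `X' = X ×_κ K`
affine ⇒ `X` affine. [cite: StacksProject, Tag 02L5] -/
theorem isAffine_of_isPullback_SpecMap_of_field {κ : Type u} [Field κ] {K : CommRingCat.{u}}
    [Nontrivial K] (φ : CommRingCat.of κ ⟶ K) {X X' : Scheme.{u}} {f : X ⟶ Spec (.of κ)}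
    {p : X' ⟶ X} {f' : X' ⟶ Spec K} (H : IsPullback p f' f (Spec.map φ)) [IsAffine X'] :
    IsAffine X := by
  obtain ⟨h₁, h₂⟩ := surjective_and_flat_SpecMap_of_field φ
  haveI := h₁
  haveI := h₂
  exact isAffine_of_isPullback_Spec φ H

/-- **An open of a `κ`-scheme whose preimage in `X ×_κ K` is affine is affine** (for the base
change `p : X ×_κ K → X` along a ring map `κ → K` into a nonzero ring).
[cite: StacksProject, Tag 02L5] -/
theorem isAffineOpen_of_isAffineOpen_preimage_of_field {κ : Type u} [Field κ] {K : CommRingCat.{u}}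
    [Nontrivial K] (φ : CommRingCat.of κ ⟶ K) {X X' : Scheme.{u}} {f : X ⟶ Spec (.of κ)}
    {p : X' ⟶ X} {f' : X' ⟶ Spec K} (H : IsPullback p f' f (Spec.map φ)) (U : X.Opens)
    (hU : IsAffineOpen (p ⁻¹ᵁ U)) : IsAffineOpen U := by
  haveI : IsAffine (p ⁻¹ᵁ U) := hU
  have HU : IsPullback (p ∣_ U) ((p ⁻¹ᵁ U).ι ≫ f') (U.ι ≫ f) (Spec.map φ) :=
    (isPullback_morphismRestrict p U).paste_vert H
  exact isAffine_of_isPullback_SpecMap_of_field φ HU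

end Literature.AlgebraicGeometry.Morphisms

end
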